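import Summits.NavierStokesRegularity.NavierStokesRegularity.Theorems.TypeICertificateLadderTargetLambEnergySlack
import Literature.Analysis.FluidPDE.VectorCalculusProofs
import HarnessLib

/-!
# Crux `Target` = `TypeICertificateLadder.NoTypeIBlowup` (stmt-NavierStokesRegularity-1217), line
# `depletion-ladder`: the LAMB–SUPERHELICITY SLACK in the enstrophy production (slice form)

`--supports stmt-NavierStokesRegularity-1217` (line `depletion-ladder`; SCALE-INVARIANT companion of
`Theorems/TypeICertificateLadderTargetLambEnergySlack.lean`, p482516).

In the multiplier form of the enstrophy balance, `∫ Σᵢ ⟪∂ᵢv, ∂ᵢW⟫ = −ν⁻¹(‖W‖₂² + ∫⟪ω × v, W⟫)`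
(`W = ∂ₜu`, `v = u(t)`, `ω = curl v`), the Lamb vector `ω × v` is orthogonal not only to `v`
(energy slack, companion file) but also to `ω`. The pairing of `W` with `ω` is again an exact
identity — the helicity-dissipation slice `∫⟪ω, W⟫ = ν ∫⟪ω, Δv⟫ = −ν ∫⟪ω, curl ω⟫` (the transport and
both gradient pairings vanish against the divergence-free `ω`; no `div v = 0` is needed) — so
testing the Lamb vector against `W + μω`, `μ = −ν∫⟪ω, Δv⟫/‖ω‖₂²`, and completing the square only in
`‖W + μω‖₂² = ‖W‖₂² − ν²(∫⟪ω, Δv⟫)²/‖ω‖₂²` gives (`integral_sum_inner_fderiv_le_lamb_helicity`)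

  `∫ Σᵢ ⟪∂ᵢv, ∂ᵢW⟫ ≤ (4ν)⁻¹ ∫ |v|²|curl v|² − ν (∫⟪curl v, Δv⟫)² / ∫|curl v|²`,

i.e. `d/dt‖∇u‖₂² ≤ (‖u‖²_∞/(2ν))‖∇u‖₂² − 2ν σ² ‖Δu‖₂²` with the SUPERHELICITY CORRELATION
`σ := ∫⟪ω, curl ω⟫/(‖ω‖₂‖curl ω‖₂) ∈ [−1, 1]` (`curl ω = −Δu`): a fraction `σ²` of the viscous
dissipation survives the Young absorption. Unlike the energy slack (`‖u‖₂²` is supercritical), this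
correction is SCALE-INVARIANT: under a Type-I rate it is of the same order `(T−t)^{−3/2}` as the
production bound. For S1: the depletion ratio obeys `R² + σ² ≤ 1` (static form, companion file) —
near-extremisers of `κ̂` have vorticity `L²`-orthogonal to its own curl.

WHAT THIS IS NOT: not a depletion constant and not a rung (`σ` is not bounded below along a flow;
Beltrami-free vorticity `σ = 0` is admissible); a structural, scale-invariant identity-plus-inequality.
Elementary. [folklore]

References: Lemarié-Rieusset 2016, Thm. 11.2; Moffatt–Tsinober, Annu. Rev. Fluid Mech. 24 (1992)
(helicity, superhelicity `∫ω·curl ω` and `dH/dt = −2ν∫ω·curl ω`); Majda–Bertozzi 2002, §2.1.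
-/

noncomputable section

open Set Filter Topology MeasureTheory
open scoped RealInnerProductSpace ENNReal NNReal Laplacian ContDiff
open Literature.Analysis.FluidPDE

namespace Summit.NavierStokesRegularity.NavierStokesRegularity.Theorems.DepletionLadder

-- the problem directory repeats the summit name (`NavierStokesRegularity/NavierStokesRegularity`)
set_option linter.dupNamespace false

open Summit.NavierStokesRegularity.NavierStokesRegularity.Theorems.RungReynoldsOne

/-- The Lamb vector is orthogonal to the vorticity: `⟪(curl v) × v, curl v⟫ = 0` pointwise.
[folklore] -/
theorem inner_cross_curl_left (a b : EuclideanSpace ℝ (Fin 3)) : ⟪cross a b, a⟫ = 0 := by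
  simp [cross, cross_apply, PiLp.inner_apply, Fin.sum_univ_three]
  ring

/-- **The enstrophy production slice bound with the Lamb–superhelicity slack (multiplier form).**
Setting of `RungReynoldsOne.integral_sum_inner_fderiv_le_lamb` (`v ∈ C²`, `W, q ∈ C¹`,
`W + (v·∇)v = νΔv − ∇q`, `div W = 0`, `|v| ≤ M`, `v, ∇v, D²v, W, ∇W, q, ∇q ∈ L²`):
`∫ Σᵢ ⟪∂ᵢv, ∂ᵢW⟫ ≤ (4ν)⁻¹ ∫ |v|²|curl v|² − ν (∫⟪curl v, Δv⟫)² / ∫|curl v|²`. Proof: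
`∫ Σᵢ⟪∂ᵢv, ∂ᵢW⟫ = −ν⁻¹(‖W‖₂² + ∫⟪curl v × v, W⟫)`; helicity slice `∫⟪curl v, W⟫ = ν∫⟪curl v, Δv⟫`
(`div curl v = 0` kills both gradient pairings; the Lamb vector is orthogonal to `curl v`); test the
Lamb pairing against `W + μ curl v`, `μ = −ν∫⟪curl v, Δv⟫/∫|curl v|²`, where
`‖W + μ curl v‖₂² = ‖W‖₂² − ν²(∫⟪curl v, Δv⟫)²/∫|curl v|²`; then `ab ≤ a²/4 + b²`. [folklore] -/
theorem integral_sum_inner_fderiv_le_lamb_helicity {ν : ℝ} (hν : 0 < ν)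
    {v W : EuclideanSpace ℝ (Fin 3) → EuclideanSpace ℝ (Fin 3)} {q : EuclideanSpace ℝ (Fin 3) → ℝ}
    (hv : ContDiff ℝ 2 v) (hW : ContDiff ℝ 1 W) (hq : ContDiff ℝ 1 q)
    (hmom : ∀ x, W x + convect v v x = ν • (Δ v) x - gradient q x)
    (hdivW : VectorCalculus.IsDivFree W) {M : ℝ} (hM : ∀ x, ‖v x‖ ≤ M)
    (hv0 : ∫⁻ x, ‖v x‖ₑ ^ 2 < ⊤)
    (hv1 : ∫⁻ x, ENNReal.ofReal (frobeniusNormSq (fderiv ℝ v x)) < ⊤)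
    (hv2 : ∫⁻ x, ‖iteratedFDeriv ℝ 2 v x‖ₑ ^ 2 < ⊤)
    (hW0 : ∫⁻ x, ‖W x‖ₑ ^ 2 < ⊤) (hW1 : ∫⁻ x, ‖iteratedFDeriv ℝ 1 W x‖ₑ ^ 2 < ⊤)
    (hq0 : ∫⁻ x, ‖q x‖ₑ ^ 2 < ⊤) (hq1 : ∫⁻ x, ‖iteratedFDeriv ℝ 1 q x‖ₑ ^ 2 < ⊤) :
    ∫ x, ∑ i, ⟪fderiv ℝ v x (EuclideanSpace.basisFun (Fin 3) ℝ i),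
        fderiv ℝ W x (EuclideanSpace.basisFun (Fin 3) ℝ i)⟫ ≤
      (4 * ν)⁻¹ * (∫ x, ‖v x‖ ^ 2 * ‖curl v x‖ ^ 2) -
        ν * (∫ x, ⟪curl v x, (Δ v) x⟫) ^ 2 / ∫ x, ‖curl v x‖ ^ 2 := by
  set e := EuclideanSpace.basisFun (Fin 3) ℝ with he
  have he1 : ∀ i, ‖e i‖ = 1 := fun i => by simp [he]
  have hM0 : 0 ≤ M := (norm_nonneg _).trans (hM 0)
  have hdv : Differentiable ℝ v := hv.differentiable two_ne_zero
  have hv' : ContDiff ℝ 1 v := hv.of_le one_le_two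
  have hω1 : ContDiff ℝ 1 (curl v) := by
    rw [curl_eq_curlCLM_comp]
    exact curlCLM.contDiff.comp (hv.fderiv_right (m := 1) (by norm_num))
  have hdivω : VectorCalculus.IsDivFree (curl v) := fun x => divergence_curl_eq_zero_holds v hv x
  -- the Bernoulli head `B = |v|²/2`, with `DB(x) = ⟪v(x), Dv(x)·⟫`
  set B : EuclideanSpace ℝ (Fin 3) → ℝ := fun y => ‖v y‖ ^ 2 / 2 with hB
  have hBc : ContDiff ℝ 1 B := ((contDiff_norm_sq ℝ).comp hv').div_const 2
  have hDB : ∀ x, fderiv ℝ B x = (innerSL ℝ (v x)).comp (fderiv ℝ v x) := fun x =>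
    (hasFDerivAt_half_norm_sq (hdv x)).fderiv
  -- continuity of all the fields involved
  have cv : Continuous v := hv.continuous
  have cDv : Continuous (fderiv ℝ v) := hv.continuous_fderiv two_ne_zero
  have cdiv : ∀ i, Continuous fun x => fderiv ℝ v x (e i) := fun i => cDv.clm_apply continuous_const
  have cddv : ∀ i, Continuous fun x => fderiv ℝ (fun y => fderiv ℝ v y (e i)) x (e i) := fun i =>
    ((((hv.fderiv_right (m := 1) le_rfl).clm_apply contDiff_const).continuous_fderiv
      one_ne_zero).clm_apply continuous_const)
  have cW : Continuous W := hW.continuous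
  have cDW : Continuous (fderiv ℝ W) := hW.continuous_fderiv one_ne_zero
  have cdiW : ∀ i, Continuous fun x => fderiv ℝ W x (e i) := fun i => cDW.clm_apply continuous_const
  have cgrad : ∀ {r : EuclideanSpace ℝ (Fin 3) → ℝ}, ContDiff ℝ 1 r → Continuous (gradient r) :=
    fun hr => (InnerProductSpace.toDual ℝ (EuclideanSpace ℝ (Fin 3))).symm.continuous.comp
      (hr.continuous_fderiv one_ne_zero)
  have cgq : Continuous (gradient q) := cgrad hq
  have cgB : Continuous (gradient B) := cgrad hBc
  have ccurl : Continuous (curl v) := hω1.continuous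
  have cdω : ∀ i, Continuous fun x => fderiv ℝ (curl v) x (e i) := fun i =>
    (hω1.continuous_fderiv one_ne_zero).clm_apply continuous_const
  have ccross : Continuous fun x => cross (curl v x) (v x) :=
    (crossCLM.continuous₂).comp (ccurl.prodMk cv) |>.congr (fun x => by simp [crossCLM_apply])
  have cLap : Continuous (Δ v) := by
    have : (Δ v) = fun x => ∑ i, fderiv ℝ (fun y => fderiv ℝ v y (e i)) x (e i) := by
      funext x; exact laplacian_eq_sum_fderiv_fderiv e hv x
    rw [this]
    exact continuous_finsetSum _ fun i _ => cddv i
  -- finite `L²` norms of the derived fields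
  have l2Dv : ∫⁻ x, ‖fderiv ℝ v x‖ₑ ^ 2 < ⊤ := lintegral_enorm_sq_fderiv_lt_top hv1
  have l2div : ∀ i, ∫⁻ x, ‖fderiv ℝ v x (e i)‖ₑ ^ 2 < ⊤ := fun i =>
    lintegral_enorm_sq_lt_top_of_norm_le (fun x => by
      simpa [he1] using (fderiv ℝ v x).le_opNorm (e i)) l2Dv
  have l2ddv : ∀ i, ∫⁻ x, ‖fderiv ℝ (fun y => fderiv ℝ v y (e i)) x (e i)‖ₑ ^ 2 < ⊤ := fun i =>
    lintegral_enorm_sq_lt_top_of_norm_le (fun x => norm_fderiv_fderiv_apply_basisFun_le hv x i) hv2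
  have l2diW : ∀ i, ∫⁻ x, ‖fderiv ℝ W x (e i)‖ₑ ^ 2 < ⊤ := fun i =>
    lintegral_enorm_sq_lt_top_of_norm_le (fun x => norm_fderiv_apply_basisFun_le W x i) hW1
  have l2diq : ∀ i, ∫⁻ x, ‖fderiv ℝ q x (e i)‖ₑ ^ 2 < ⊤ := fun i =>
    lintegral_enorm_sq_lt_top_of_norm_le (fun x => norm_fderiv_apply_basisFun_le q x i) hq1
  have l2gq : ∫⁻ x, ‖gradient q x‖ₑ ^ 2 < ⊤ := by
    refine lintegral_enorm_sq_lt_top_of_norm_le (fun x => ?_) hq1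
    rw [gradient, LinearIsometryEquiv.norm_map, ← norm_iteratedFDeriv_fderiv,
      norm_iteratedFDeriv_zero]
  have l2MDv : ∫⁻ x, ‖M * ‖fderiv ℝ v x‖‖ₑ ^ 2 < ⊤ :=
    lintegral_enorm_sq_const_mul_norm_lt_top M l2Dv
  have hDBle : ∀ x, ‖fderiv ℝ B x‖ ≤ ‖M * ‖fderiv ℝ v x‖‖ := fun x => by
    rw [hDB x]
    refine ((ContinuousLinearMap.opNorm_comp_le _ _).trans ?_).trans (Real.le_norm_self _)
    rw [innerSL_apply_norm]
    exact mul_le_mul_of_nonneg_right (hM x) (norm_nonneg _)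
  have l2diB : ∀ i, ∫⁻ x, ‖fderiv ℝ B x (e i)‖ₑ ^ 2 < ⊤ := fun i =>
    lintegral_enorm_sq_lt_top_of_norm_le (fun x =>
      le_trans (by simpa [he1] using (fderiv ℝ B x).le_opNorm (e i)) (hDBle x)) l2MDv
  have l2gB : ∫⁻ x, ‖gradient B x‖ₑ ^ 2 < ⊤ :=
    lintegral_enorm_sq_lt_top_of_norm_le (fun x => by
      rw [gradient, LinearIsometryEquiv.norm_map]; exact hDBle x) l2MDv
  have l2B : ∫⁻ x, ‖B x‖ₑ ^ 2 < ⊤ := by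
    refine lintegral_enorm_sq_lt_top_of_norm_le (b := fun x => M / 2 * ‖v x‖) (fun x => ?_)
      (lintegral_enorm_sq_const_mul_norm_lt_top _ hv0)
    refine le_trans ?_ (Real.le_norm_self _)
    simp only [hB]
    rw [Real.norm_of_nonneg (by positivity)]
    nlinarith [hM x, norm_nonneg (v x)]
  have l2ω : ∫⁻ x, ‖curl v x‖ₑ ^ 2 < ⊤ :=
    lintegral_enorm_sq_lt_top_of_norm_le (b := fun x => ‖curlCLM‖ * ‖fderiv ℝ v x‖)
      (fun x => (norm_curl_le v x).trans (Real.le_norm_self _))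
      (lintegral_enorm_sq_const_mul_norm_lt_top _ l2Dv)
  have l2dω : ∀ i, ∫⁻ x, ‖fderiv ℝ (curl v) x (e i)‖ₑ ^ 2 < ⊤ := fun i => by
    refine lintegral_enorm_sq_lt_top_of_norm_le (b := fun x => ‖curlCLM‖ * ‖iteratedFDeriv ℝ 2 v x‖)
      (fun x => le_trans ?_ (Real.le_norm_self _)) (lintegral_enorm_sq_const_mul_norm_lt_top _ hv2)
    calc ‖fderiv ℝ (curl v) x (e i)‖ ≤ ‖fderiv ℝ (curl v) x‖ := by
          simpa [he1] using (fderiv ℝ (curl v) x).le_opNorm (e i)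
      _ ≤ ‖curlCLM‖ * ‖iteratedFDeriv ℝ 2 v x‖ := norm_fderiv_curl_le hv x
  have l2curl : ∫⁻ x, ‖M * ‖curl v x‖‖ₑ ^ 2 < ⊤ := lintegral_enorm_sq_const_mul_norm_lt_top M l2ω
  have l2cross : ∫⁻ x, ‖cross (curl v x) (v x)‖ₑ ^ 2 < ⊤ := by
    refine lintegral_enorm_sq_lt_top_of_norm_le (b := fun x => M * ‖curl v x‖) (fun x => ?_) l2curl
    refine le_trans ?_ (Real.le_norm_self _)
    have hcr : ‖cross (curl v x) (v x)‖ ≤ ‖v x‖ * ‖curl v x‖ := by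
      rw [norm_cross, mul_comm ‖v x‖]
      nlinarith [Real.sin_le_one (InnerProductGeometry.angle (curl v x) (v x)),
        mul_nonneg (norm_nonneg (curl v x)) (norm_nonneg (v x))]
    exact hcr.trans (mul_le_mul_of_nonneg_right (hM x) (norm_nonneg _))
  have l2Lap : ∫⁻ x, ‖(Δ v) x‖ₑ ^ 2 < ⊤ := by
    refine lintegral_enorm_sq_lt_top_of_norm_le (b := fun x => (3 : ℝ) * ‖iteratedFDeriv ℝ 2 v x‖)
      (fun x => ?_) (lintegral_enorm_sq_const_mul_norm_lt_top _ hv2)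
    refine le_trans ?_ (Real.le_norm_self _)
    rw [laplacian_eq_sum_fderiv_fderiv e hv x]
    calc ‖∑ i, fderiv ℝ (fun y => fderiv ℝ v y (e i)) x (e i)‖
        ≤ ∑ i, ‖fderiv ℝ (fun y => fderiv ℝ v y (e i)) x (e i)‖ := norm_sum_le _ _
      _ ≤ ∑ _i : Fin 3, ‖iteratedFDeriv ℝ 2 v x‖ :=
          Finset.sum_le_sum fun i _ => norm_fderiv_fderiv_apply_basisFun_le hv x i
      _ = 3 * ‖iteratedFDeriv ℝ 2 v x‖ := by simp
  -- integrability of the products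
  have i1 : ∀ i, Integrable (fun x => ⟪fderiv ℝ (fun y => fderiv ℝ v y (e i)) x (e i), W x⟫)
      volume := fun i =>
    integrable_of_norm_le_mul_of_lintegral_sq ((cddv i).inner cW).aestronglyMeasurable (cddv i) cW
      (l2ddv i) hW0 fun x => norm_inner_le_norm _ _
  have i2 : ∀ i, Integrable (fun x => ⟪fderiv ℝ v x (e i), fderiv ℝ W x (e i)⟫) volume := fun i =>
    integrable_of_norm_le_mul_of_lintegral_sq ((cdiv i).inner (cdiW i)).aestronglyMeasurable
      (cdiv i) (cdiW i) (l2div i) (l2diW i) fun x => norm_inner_le_norm _ _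
  have i3 : ∀ i, Integrable (fun x => ⟪fderiv ℝ v x (e i), W x⟫) volume := fun i =>
    integrable_of_norm_le_mul_of_lintegral_sq ((cdiv i).inner cW).aestronglyMeasurable (cdiv i) cW
      (l2div i) hW0 fun x => norm_inner_le_norm _ _
  have iωLap : Integrable (fun x => ⟪curl v x, (Δ v) x⟫) volume :=
    integrable_of_norm_le_mul_of_lintegral_sq (ccurl.inner cLap).aestronglyMeasurable ccurl cLap
      l2ω l2Lap fun x => norm_inner_le_norm _ _
  have igW : Integrable (fun x => ⟪gradient q x, W x⟫) volume :=
    integrable_of_norm_le_mul_of_lintegral_sq (cgq.inner cW).aestronglyMeasurable cgq cW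
      l2gq hW0 fun x => norm_inner_le_norm _ _
  have igB : Integrable (fun x => ⟪gradient B x, W x⟫) volume :=
    integrable_of_norm_le_mul_of_lintegral_sq (cgB.inner cW).aestronglyMeasurable cgB cW
      l2gB hW0 fun x => norm_inner_le_norm _ _
  have igqω : Integrable (fun x => ⟪gradient q x, curl v x⟫) volume :=
    integrable_of_norm_le_mul_of_lintegral_sq (cgq.inner ccurl).aestronglyMeasurable cgq ccurl
      l2gq l2ω fun x => norm_inner_le_norm _ _
  have igBω : Integrable (fun x => ⟪gradient B x, curl v x⟫) volume :=
    integrable_of_norm_le_mul_of_lintegral_sq (cgB.inner ccurl).aestronglyMeasurable cgB ccurl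
      l2gB l2ω fun x => norm_inner_le_norm _ _
  have iWW : Integrable (fun x => ⟪W x, W x⟫) volume :=
    integrable_of_norm_le_mul_of_lintegral_sq (cW.inner cW).aestronglyMeasurable cW cW
      hW0 hW0 fun x => norm_inner_le_norm _ _
  have icW : Integrable (fun x => ⟪cross (curl v x) (v x), W x⟫) volume :=
    integrable_of_norm_le_mul_of_lintegral_sq (ccross.inner cW).aestronglyMeasurable ccross cW
      l2cross hW0 fun x => norm_inner_le_norm _ _
  have iωW : Integrable (fun x => ⟪curl v x, W x⟫) volume :=
    integrable_of_norm_le_mul_of_lintegral_sq (ccurl.inner cW).aestronglyMeasurable ccurl cW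
      l2ω hW0 fun x => norm_inner_le_norm _ _
  have ivo : Integrable (fun x => ‖v x‖ ^ 2 * ‖curl v x‖ ^ 2) volume := by
    refine integrable_of_norm_le_mul_of_lintegral_sq (a := fun x => M * ‖curl v x‖)
      (b := fun x => M * ‖curl v x‖) ((cv.norm.pow 2).mul (ccurl.norm.pow 2)).aestronglyMeasurable
      (continuous_const.mul ccurl.norm) (continuous_const.mul ccurl.norm) l2curl l2curl fun x => ?_
    rw [Real.norm_of_nonneg (by positivity), Real.norm_of_nonneg (mul_nonneg hM0 (norm_nonneg _))]
    calc ‖v x‖ ^ 2 * ‖curl v x‖ ^ 2 ≤ M ^ 2 * ‖curl v x‖ ^ 2 := by gcongr; exact hM x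
      _ = M * ‖curl v x‖ * (M * ‖curl v x‖) := by ring
  have mL : MemLp (fun x => cross (curl v x) (v x)) 2 volume :=
    (memLp_two_iff_integrable_sq_norm ccross.aestronglyMeasurable).2
      (integrable_sq_norm_of_lintegral_lt_top ccross l2cross)
  have mW : MemLp W 2 volume :=
    (memLp_two_iff_integrable_sq_norm cW.aestronglyMeasurable).2
      (integrable_sq_norm_of_lintegral_lt_top cW hW0)
  have mω : MemLp (curl v) 2 volume :=
    (memLp_two_iff_integrable_sq_norm ccurl.aestronglyMeasurable).2
      (integrable_sq_norm_of_lintegral_lt_top ccurl l2ω)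
  have isqω : Integrable (fun x => ‖curl v x‖ ^ 2) volume :=
    integrable_sq_norm_of_lintegral_lt_top ccurl l2ω
  have isqW : Integrable (fun x => ‖W x‖ ^ 2) volume := integrable_sq_norm_of_lintegral_lt_top cW hW0
  have isqc : Integrable (fun x => ‖cross (curl v x) (v x)‖ ^ 2) volume :=
    integrable_sq_norm_of_lintegral_lt_top ccross l2cross
  -- the gradient pairings vanish (against `W` and against `curl v`)
  have hin : ∀ i (y : EuclideanSpace ℝ (Fin 3)), ‖⟪e i, y⟫‖ ≤ ‖y‖ := fun i y =>
    (norm_inner_le_norm (𝕜 := ℝ) (e i) y).trans (by rw [he1, one_mul])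
  have hpair : ∀ {r : EuclideanSpace ℝ (Fin 3) → ℝ} {Y : EuclideanSpace ℝ (Fin 3) → EuclideanSpace ℝ (Fin 3)},
      ContDiff ℝ 1 r → (∫⁻ x, ‖r x‖ₑ ^ 2 < ⊤) → (∀ i, ∫⁻ x, ‖fderiv ℝ r x (e i)‖ₑ ^ 2 < ⊤) →
      ContDiff ℝ 1 Y → VectorCalculus.IsDivFree Y → (∫⁻ x, ‖Y x‖ₑ ^ 2 < ⊤) →
      (∀ i, ∫⁻ x, ‖fderiv ℝ Y x (e i)‖ₑ ^ 2 < ⊤) → ∫ x, ⟪gradient r x, Y x⟫ = 0 := by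
    intro r Y hr l2r l2dir hY hdivY hY0 l2diY
    have cr : Continuous r := hr.continuous
    have cY : Continuous Y := hY.continuous
    have cdiY : ∀ i, Continuous fun x => fderiv ℝ Y x (e i) := fun i =>
      (hY.continuous_fderiv one_ne_zero).clm_apply continuous_const
    have cdir : ∀ i, Continuous fun x => fderiv ℝ r x (e i) := fun i =>
      (hr.continuous_fderiv one_ne_zero).clm_apply continuous_const
    refine integral_inner_gradient_eq_zero_of_isDivFree_R3 hr hY hdivY (fun i => ?_) (fun i => ?_)
      (fun i => ?_)
    · exact integrable_of_norm_le_mul_of_lintegral_sq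
        ((continuous_const.inner cY).mul (cdir i)).aestronglyMeasurable cY (cdir i) hY0 (l2dir i)
        fun x => by rw [norm_mul]; exact mul_le_mul_of_nonneg_right (hin i _) (norm_nonneg _)
    · exact integrable_of_norm_le_mul_of_lintegral_sq
        ((continuous_const.inner (cdiY i)).mul cr).aestronglyMeasurable (cdiY i) cr (l2diY i) l2r
        fun x => by rw [norm_mul]; exact mul_le_mul_of_nonneg_right (hin i _) (norm_nonneg _)
    · exact integrable_of_norm_le_mul_of_lintegral_sq
        ((continuous_const.inner cY).mul cr).aestronglyMeasurable cY cr hY0 l2r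
        fun x => by rw [norm_mul]; exact mul_le_mul_of_nonneg_right (hin i _) (norm_nonneg _)
  have hpress : ∫ x, ⟪gradient q x, W x⟫ = 0 := hpair hq hq0 l2diq hW hdivW hW0 l2diW
  have hpressB : ∫ x, ⟪gradient B x, W x⟫ = 0 := hpair hBc l2B l2diB hW hdivW hW0 l2diW
  have hpressω : ∫ x, ⟪gradient q x, curl v x⟫ = 0 := hpair hq hq0 l2diq hω1 hdivω l2ω l2dω
  have hpressBω : ∫ x, ⟪gradient B x, curl v x⟫ = 0 := hpair hBc l2B l2diB hω1 hdivω l2ω l2dω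
  set Z : ℝ := ∫ x, ‖curl v x‖ ^ 2 with hZ
  set h₂ : ℝ := ∫ x, ⟪curl v x, (Δ v) x⟫ with hh₂
  set w2 : ℝ := ∫ x, ‖W x‖ ^ 2 with hw2
  set pc : ℝ := ∫ x, ⟪cross (curl v x) (v x), W x⟫ with hpc
  set a2 : ℝ := ∫ x, ‖cross (curl v x) (v x)‖ ^ 2 with ha2
  set P2 : ℝ := ∫ x, ‖v x‖ ^ 2 * ‖curl v x‖ ^ 2 with hP2
  have hZ0 : 0 ≤ Z := integral_nonneg fun x => sq_nonneg _
  have ha20 : 0 ≤ a2 := integral_nonneg fun x => sq_nonneg _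
  -- `a2 ≤ P2` (pointwise `|curl v × v| ≤ |v||curl v|`)
  have ha2P2 : a2 ≤ P2 := by
    refine integral_mono isqc ivo fun x => ?_
    have hcr : ‖cross (curl v x) (v x)‖ ≤ ‖v x‖ * ‖curl v x‖ := by
      rw [norm_cross, mul_comm ‖v x‖]
      nlinarith [Real.sin_le_one (InnerProductGeometry.angle (curl v x) (v x)),
        mul_nonneg (norm_nonneg (curl v x)) (norm_nonneg (v x))]
    have h0 : 0 ≤ ‖cross (curl v x) (v x)‖ := norm_nonneg _
    calc ‖cross (curl v x) (v x)‖ ^ 2 ≤ (‖v x‖ * ‖curl v x‖) ^ 2 := pow_le_pow_left₀ h0 hcr 2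
      _ = ‖v x‖ ^ 2 * ‖curl v x‖ ^ 2 := by ring
  -- THE HELICITY SLICE: `∫⟪curl v, W⟫ = ν h₂`
  have hωW_pt : ∀ x, ⟪curl v x, W x⟫ =
      ν * ⟪curl v x, (Δ v) x⟫ - ⟪gradient B x, curl v x⟫ - ⟪gradient q x, curl v x⟫ := by
    intro x
    have hWx : W x = ν • (Δ v) x - convect v v x - gradient q x := by
      rw [eq_sub_of_add_eq (hmom x)]
      abel
    have hL : convect v v x = cross (curl v x) (v x) + gradient B x :=
      convect_self_eq_cross_curl_add_gradient (hdv x)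
    have h0 : ⟪curl v x, cross (curl v x) (v x)⟫ = 0 := by
      rw [real_inner_comm]; exact inner_cross_curl_left _ _
    rw [hWx, hL, inner_sub_right, inner_sub_right, real_inner_smul_right, inner_add_right, h0,
      zero_add, real_inner_comm (gradient B x) (curl v x), real_inner_comm (gradient q x) (curl v x)]
  have hHW : ∫ x, ⟪curl v x, W x⟫ = ν * h₂ := by
    have iA1 : Integrable (fun x => ν * ⟪curl v x, (Δ v) x⟫ - ⟪gradient B x, curl v x⟫) volume :=
      (iωLap.const_mul ν).sub igBω
    have iA0 : Integrable (fun x => ν * ⟪curl v x, (Δ v) x⟫) volume := iωLap.const_mul ν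
    rw [integral_congr_ae (Eventually.of_forall hωW_pt), integral_sub iA1 igqω,
      integral_sub iA0 igBω, integral_const_mul, hpressBω, hpressω]
    ring
  -- THE MAIN IDENTITY: `∫ Σᵢ⟪∂ᵢv, ∂ᵢW⟫ = −ν⁻¹ (w2 + pc)`
  have hLap := integral_sum_inner_fderiv_fderiv_eq_neg_integral_inner_laplacian hv hW i1 i2 i3
  have hpt : ∀ x, ⟪(Δ v) x, W x⟫ = ν⁻¹ * (⟪W x, W x⟫ + ⟪cross (curl v x) (v x), W x⟫ +
      ⟪gradient B x, W x⟫ + ⟪gradient q x, W x⟫) := by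
    intro x
    have hΔ : (Δ v) x = ν⁻¹ • (W x + convect v v x + gradient q x) := by
      have h := hmom x
      rw [eq_sub_iff_add_eq] at h
      rw [h, smul_smul, inv_mul_cancel₀ hν.ne', one_smul]
    have hL : convect v v x = cross (curl v x) (v x) + gradient B x :=
      convect_self_eq_cross_curl_add_gradient (hdv x)
    rw [hΔ, hL, real_inner_smul_left, inner_add_left, inner_add_left, inner_add_left]
    ring
  have hWW : ∫ x, ⟪W x, W x⟫ = w2 :=
    integral_congr_ae (Eventually.of_forall fun x => real_inner_self_eq_norm_sq _)
  have hI : ∫ x, ∑ i, ⟪fderiv ℝ v x (e i), fderiv ℝ W x (e i)⟫ = -(ν⁻¹ * (w2 + pc)) := by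
    have iS1 : Integrable (fun x => ⟪W x, W x⟫ + ⟪cross (curl v x) (v x), W x⟫) volume :=
      iWW.add icW
    have iS2 : Integrable (fun x => ⟪W x, W x⟫ + ⟪cross (curl v x) (v x), W x⟫ +
        ⟪gradient B x, W x⟫) volume := iS1.add igB
    rw [hLap, integral_congr_ae (Eventually.of_forall hpt), integral_const_mul,
      integral_add iS2 igW, integral_add iS1 igB, integral_add iWW icW, hpress, hpressB, add_zero,
      add_zero, hWW]
  -- THE LAMB–SUPERHELICITY SLACK: test against `W + μ curl v`, `μ = −ν h₂/Z`
  set lam : ℝ := -(ν * h₂ / Z) with hlam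
  have hX2 : ∫ x, ‖W x + lam • curl v x‖ ^ 2 = w2 - ν ^ 2 * h₂ ^ 2 / Z := by
    have hexp : ∀ x, ‖W x + lam • curl v x‖ ^ 2 =
        ‖W x‖ ^ 2 + 2 * lam * ⟪curl v x, W x⟫ + lam ^ 2 * ‖curl v x‖ ^ 2 := by
      intro x
      rw [norm_add_sq_real, norm_smul, real_inner_smul_right, real_inner_comm, mul_pow,
        Real.norm_eq_abs, sq_abs]
      ring
    have hA : Integrable (fun x => ‖W x‖ ^ 2 + 2 * lam * ⟪curl v x, W x⟫) volume :=
      isqW.add (iωW.const_mul (2 * lam))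
    have hBB : Integrable (fun x => lam ^ 2 * ‖curl v x‖ ^ 2) volume := isqω.const_mul (lam ^ 2)
    have hA2 : Integrable (fun x => 2 * lam * ⟪curl v x, W x⟫) volume := iωW.const_mul (2 * lam)
    have hint : ∫ x, ‖W x + lam • curl v x‖ ^ 2 =
        w2 + 2 * lam * (∫ x, ⟪curl v x, W x⟫) + lam ^ 2 * Z := by
      rw [integral_congr_ae (Eventually.of_forall hexp), integral_add hA hBB, integral_add isqW hA2,
        integral_const_mul, integral_const_mul]
    rw [hint, hHW]
    rcases eq_or_lt_of_le hZ0 with hZ00 | hZpos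
    · have hl0 : lam = 0 := by rw [hlam, ← hZ00, div_zero, neg_zero]
      rw [hl0, ← hZ00]
      simp
    · rw [hlam]
      field_simp
      ring
  have hX0 : 0 ≤ w2 - ν ^ 2 * h₂ ^ 2 / Z := by
    rw [← hX2]; exact integral_nonneg fun x => sq_nonneg _
  have hCS : |pc| ≤ Real.sqrt a2 * Real.sqrt (w2 - ν ^ 2 * h₂ ^ 2 / Z) := by
    rw [← hX2]
    exact abs_integral_inner_le_of_inner_eq_zero (fun x => inner_cross_curl_left _ _) mL mW mω lam
  -- `ab ≤ a²/4 + b²`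
  have hkey : -(w2 + pc) ≤ a2 / 4 - ν ^ 2 * h₂ ^ 2 / Z := by
    have h1 : -pc ≤ Real.sqrt a2 * Real.sqrt (w2 - ν ^ 2 * h₂ ^ 2 / Z) :=
      (neg_le_abs pc).trans hCS
    have hsa : Real.sqrt a2 ^ 2 = a2 := Real.sq_sqrt ha20
    have hsX : Real.sqrt (w2 - ν ^ 2 * h₂ ^ 2 / Z) ^ 2 = w2 - ν ^ 2 * h₂ ^ 2 / Z := Real.sq_sqrt hX0
    nlinarith [sq_nonneg (Real.sqrt a2 / 2 - Real.sqrt (w2 - ν ^ 2 * h₂ ^ 2 / Z))]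
  -- assemble
  rw [hI]
  have hνi : 0 < ν⁻¹ := inv_pos.2 hν
  calc -(ν⁻¹ * (w2 + pc)) = ν⁻¹ * (-(w2 + pc)) := by ring
    _ ≤ ν⁻¹ * (a2 / 4 - ν ^ 2 * h₂ ^ 2 / Z) := mul_le_mul_of_nonneg_left hkey hνi.le
    _ = (4 * ν)⁻¹ * a2 - ν * h₂ ^ 2 / Z := by
        field_simp
    _ ≤ (4 * ν)⁻¹ * P2 - ν * h₂ ^ 2 / Z := by
        gcongr

end Summit.NavierStokesRegularity.NavierStokesRegularity.Theorems.DepletionLadder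

end
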